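import Summits.ValiantsHypothesis.ValiantsHypothesis.Theorems.KPlusLogSqLawStaticPathUnique

/-!
# Route «KPlusLogSqLaw» — parametric max-weight independent set on a path: a 4-item block with 5 changes (kernel certificate pilot)

HONEST FRAMING.  Helper toward the crux `WeakLifting` (item `stmt-ValiantsHypothesis-19561`, route `KPlusLogSqLaw`, cell `pub-symmetroid`,
seat val-sym-lift-p4 g8, 2026-08-27) on the line of its witness-plan stub `stub_tridiagonalSectorB` (tropical twin of the STATIC tridiagonal
sector = parametric maximum-weight independent set on a path).  PILOT of the DIRECT CERTIFICATE route for turning located counts into kernel floors: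
an explicit 4-item block (`w_1 = -4θ-5`, `w_2 = -θ+7`, `w_3 = θ+7`, `w_4 = 4θ-9`) with a chain of SIX unique optima `{1}, {1,3}, {2}, {3}, {2,4}, {4}`
at `θ = -8, -5, -1, 2, 5, 8` (`exists_chain_five_on_four`): rate `5/4 > 1`, so the all-`n` floor `exists_chain_length` (rate 1) is not sharp, in
line with the located exact value `bp(4) = 5` (val-sym-lift-p4 g7 / val-sym-trop-p2 g14, exhaustive).  Certificate shape (re-usable by a generator for
the located maximisers `n ≤ 15` and for the F6 blocks): optimal VALUE by the dynamic programme `F` (`opt_eq_F`, `F_add_two`) evaluated level by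
level, UNIQUENESS by `unique_of_distinct` (pairwise distinct prefix-sum values at each sample), membership / distinctness of the sets by `decide`.
Nothing here asserts anything about `WeakLifting`, `TropicalB`, `KPlusLogSqLaw`, the stub in its window, `MatrixDescartes` (stmt-ValiantsHypothesis-18050)
or `VP ≠ VNP`.
-/

set_option linter.dupNamespace false
set_option autoImplicit false

namespace Summit.ValiantsHypothesis.ValiantsHypothesis.Theorems.KPlusLogSqLaw

open Finset Classical

namespace StaticPathFold

noncomputable section

/-- **a 4-item block with a chain of 5 changes of the unique optimum** (kernel certificate; located: `bp(4) = 5` exactly). [folklore] -/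
theorem exists_chain_five_on_four :
    ∃ (w₁ w₀ : ℕ → ℝ) (θs : Fin 6 → ℝ) (Ms : Fin 6 → Finset ℕ),
      StrictMono θs ∧ (∀ k, Ms k ∈ indepSets 0 4) ∧
      (∀ k, ∀ S ∈ indepSets 0 4, S ≠ Ms k → ∑ t ∈ S, W w₁ w₀ t (θs k) < ∑ t ∈ Ms k, W w₁ w₀ t (θs k)) ∧
      (∀ e : Fin 5, Ms e.castSucc ≠ Ms e.succ) := by
  -- the instance
  set w₁ : ℕ → ℝ := fun t => if t = 1 then -4 else if t = 2 then -1 else if t = 3 then 1 else if t = 4 then 4 else 0 with hw₁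
  set w₀ : ℕ → ℝ := fun t => if t = 1 then -5 else if t = 2 then 7 else if t = 3 then 7 else if t = 4 then -9 else 0 with hw₀
  set θs : Fin 6 → ℝ := ![-8, -5, -1, 2, 5, 8] with hθs
  set Ms : Fin 6 → Finset ℕ := ![{1}, {1, 3}, {2}, {3}, {2, 4}, {4}] with hMs
  -- item weights in closed form
  have hW1 : ∀ θ : ℝ, W w₁ w₀ 1 θ = -4 * θ - 5 := fun θ => by simp [W, hw₁, hw₀]; ring
  have hW2 : ∀ θ : ℝ, W w₁ w₀ 2 θ = -θ + 7 := fun θ => by simp [W, hw₁, hw₀]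
  have hW3 : ∀ θ : ℝ, W w₁ w₀ 3 θ = θ + 7 := fun θ => by simp [W, hw₁, hw₀]
  have hW4 : ∀ θ : ℝ, W w₁ w₀ 4 θ = 4 * θ - 9 := fun θ => by simp [W, hw₁, hw₀]; ring
  -- the dynamic programme, level by level
  have hF : ∀ θ : ℝ, opt w₁ w₀ 0 4 θ =
      max (max (max (max 0 (-4 * θ - 5)) (0 + (-θ + 7))) (max 0 (-4 * θ - 5) + (θ + 7)))
        (max (max 0 (-4 * θ - 5)) (0 + (-θ + 7)) + (4 * θ - 9)) := by
    intro θ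
    rw [opt_eq_F]
    have e0 : F (shift 0 w₁) (shift 0 w₀) 0 θ = 0 := rfl
    have e1 : F (shift 0 w₁) (shift 0 w₀) 1 θ = max 0 (W w₁ w₀ 1 θ) := by
      show max 0 (W (shift 0 w₁) (shift 0 w₀) 1 θ) = _; rw [W_shift]
    have e2 : F (shift 0 w₁) (shift 0 w₀) 2 θ = max (F (shift 0 w₁) (shift 0 w₀) 1 θ) (F (shift 0 w₁) (shift 0 w₀) 0 θ + W w₁ w₀ 2 θ) := by
      rw [← W_shift w₁ w₀ 0 2]; exact F_add_two _ _ 0 θ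
    have e3 : F (shift 0 w₁) (shift 0 w₀) 3 θ = max (F (shift 0 w₁) (shift 0 w₀) 2 θ) (F (shift 0 w₁) (shift 0 w₀) 1 θ + W w₁ w₀ 3 θ) := by
      rw [← W_shift w₁ w₀ 0 3]; exact F_add_two _ _ 1 θ
    have e4 : F (shift 0 w₁) (shift 0 w₀) 4 θ = max (F (shift 0 w₁) (shift 0 w₀) 3 θ) (F (shift 0 w₁) (shift 0 w₀) 2 θ + W w₁ w₀ 4 θ) := by
      rw [← W_shift w₁ w₀ 0 4]; exact F_add_two _ _ 2 θ
    rw [e4, e3, e2, e1, e0, hW1, hW2, hW3, hW4]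
  -- the signed prefix-sum lines: slopes 0, 4, 3, 2, 6 and intercepts 0, 5, 12, 5, -4
  have hS : ∀ (x : ℕ) (θ : ℝ), x ≤ 4 → L (altA (shift 0 w₁)) (altB (shift 0 w₀)) x θ =
      if x = 0 then 0 else if x = 1 then 4 * θ + 5 else if x = 2 then 3 * θ + 12 else if x = 3 then 2 * θ + 5 else 6 * θ - 4 := by
    intro x θ hx
    interval_cases x <;> simp [L, altA, altB, shift, hw₁, hw₀]
    all_goals ring
  -- distinct prefix-sum values at the six samples
  have hdis : ∀ k : Fin 6, ∀ p q, p ≤ 4 → q ≤ 4 → p ≠ q →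
      L (altA (shift 0 w₁)) (altB (shift 0 w₀)) p (θs k) ≠ L (altA (shift 0 w₁)) (altB (shift 0 w₀)) q (θs k) := by
    intro k p q hp hq hpq
    rw [hS p _ hp, hS q _ hq]
    fin_cases k <;> simp [hθs] <;> interval_cases p <;> interval_cases q <;> first | exact absurd rfl hpq | norm_num
  -- membership, optimality
  have hmem : ∀ k : Fin 6, Ms k ∈ indepSets 0 4 := by
    intro k
    rw [mem_indepSets]
    fin_cases k <;> simp [hMs, Indep, Finset.insert_subset_iff]
  have hopt : ∀ k : Fin 6, ∑ t ∈ Ms k, W w₁ w₀ t (θs k) = opt w₁ w₀ 0 4 (θs k) := by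
    intro k
    rw [hF]
    fin_cases k <;> simp [hMs, hθs, hW1, hW2, hW3, hW4] <;> norm_num
  refine ⟨w₁, w₀, θs, Ms, ?_, hmem, fun k => unique_of_distinct w₁ w₀ (hdis k) (hmem k) (hopt k), ?_⟩
  · rw [Fin.strictMono_iff_lt_succ]
    intro i
    fin_cases i <;> simp [hθs] <;> norm_num
  · intro e
    fin_cases e <;> simp [hMs] <;> decide

end

end StaticPathFold

end Summit.ValiantsHypothesis.ValiantsHypothesis.Theorems.KPlusLogSqLaw
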